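import Mathlib

/-!
# Scalar weights for a Floquet pair: the modal optimum and the two-cycle invariant
(solo-blind, s53; paper §24.51(1))

For the fibre system the resonant factor of the resolvent in a norm weighted by a scalar
`t`-periodic weight `w > 0` is governed by the weighted pair number
`k_F[w]² = ⨍ |φ₁|²/w² · ⨍ w²|ψ₁|² / p²`.  Two elementary facts used in §24.51:

1. (modal optimum) by Cauchy–Schwarz `⨍ A/w · ⨍ w B ≥ (⨍ √(A B))²` for every positive weight,
   with equality at `w = √(A/B)`; so no scalar weight beats `k_pair = ⨍|φ₁||ψ₁| / |p|`
   (finite-sample forms `weighted_pair_ge` / `weighted_pair_eq_at_opt`);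
2. (two-cycle invariant) conjugating a kernel by a scalar weight, `G_w(t,s) = w(t)⁻¹ w(s) G(t,s)`,
   leaves every product `‖G_w(t,s)‖ ‖G_w(s,t)‖` unchanged (`two_cycle_invariant`).
-/

namespace Summit.AnomalousDissipation.AnomalousDissipation.Theorems

/-- Cauchy–Schwarz lower bound for scalar-weighted pair numbers (finite-sample form):
for positive weights `w`, `(∑ √(A·B))² ≤ (∑ A/w)(∑ w·B)`. -/
theorem weighted_pair_ge {ι : Type*} (s : Finset ι) (A B w : ι → ℝ)
    (hA : ∀ i ∈ s, 0 ≤ A i) (hB : ∀ i ∈ s, 0 ≤ B i) (hw : ∀ i ∈ s, 0 < w i) :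
    (∑ i ∈ s, Real.sqrt (A i * B i)) ^ 2 ≤ (∑ i ∈ s, A i / w i) * (∑ i ∈ s, w i * B i) := by
  have key := Finset.sum_mul_sq_le_sq_mul_sq s (fun i => Real.sqrt (A i / w i))
    (fun i => Real.sqrt (w i * B i))
  have h1 : ∀ i ∈ s, Real.sqrt (A i / w i) * Real.sqrt (w i * B i) = Real.sqrt (A i * B i) := by
    intro i hi
    have hwi : w i ≠ 0 := (hw i hi).ne'
    rw [← Real.sqrt_mul (div_nonneg (hA i hi) (hw i hi).le)]
    congr 1
    field_simp
  have h2 : ∀ i ∈ s, Real.sqrt (A i / w i) ^ 2 = A i / w i :=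
    fun i hi => Real.sq_sqrt (div_nonneg (hA i hi) (hw i hi).le)
  have h3 : ∀ i ∈ s, Real.sqrt (w i * B i) ^ 2 = w i * B i :=
    fun i hi => Real.sq_sqrt (mul_nonneg (hw i hi).le (hB i hi))
  rw [Finset.sum_congr rfl h1, Finset.sum_congr rfl h2, Finset.sum_congr rfl h3] at key
  exact key

/-- The optimum is attained: at `w = √(A/B)` both weighted sums equal `∑ √(A B)`, so the product
is exactly `(∑ √(A B))²` (the optimal scalar weight is `log w* = ½ (log A − log B)`). -/
theorem weighted_pair_eq_at_opt {ι : Type*} (s : Finset ι) (A B : ι → ℝ)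
    (hA : ∀ i ∈ s, 0 < A i) (hB : ∀ i ∈ s, 0 < B i) :
    (∑ i ∈ s, A i / Real.sqrt (A i / B i)) * (∑ i ∈ s, Real.sqrt (A i / B i) * B i)
      = (∑ i ∈ s, Real.sqrt (A i * B i)) ^ 2 := by
  have hsq : ∀ i ∈ s, Real.sqrt (A i * B i) * Real.sqrt (A i / B i) = A i := by
    intro i hi
    have hBi : B i ≠ 0 := (hB i hi).ne'
    rw [← Real.sqrt_mul (mul_nonneg (hA i hi).le (hB i hi).le),
      show A i * B i * (A i / B i) = A i * A i by field_simp,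
      Real.sqrt_mul_self (hA i hi).le]
  have hpos : ∀ i ∈ s, 0 < Real.sqrt (A i / B i) :=
    fun i hi => Real.sqrt_pos.mpr (div_pos (hA i hi) (hB i hi))
  have h1 : ∀ i ∈ s, A i / Real.sqrt (A i / B i) = Real.sqrt (A i * B i) := by
    intro i hi
    rw [div_eq_iff (hpos i hi).ne', hsq i hi]
  have h2 : ∀ i ∈ s, Real.sqrt (A i / B i) * B i = Real.sqrt (A i * B i) := by
    intro i hi
    have hBi : B i ≠ 0 := (hB i hi).ne'
    have : Real.sqrt (A i / B i) = Real.sqrt (A i * B i) / B i := by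
      rw [eq_div_iff hBi]
      nth_rewrite 2 [← Real.sqrt_mul_self (hB i hi).le]
      rw [← Real.sqrt_mul (div_nonneg (hA i hi).le (hB i hi).le)]
      congr 1
      field_simp
    rw [this, div_mul_cancel₀ _ hBi]
  rw [Finset.sum_congr rfl h1, Finset.sum_congr rfl h2, sq]

/-- Two-cycle invariant of scalar conjugation: `‖(a⁻¹ b) X‖ ‖(b⁻¹ a) Y‖ = ‖X‖ ‖Y‖`
(the products `‖G(t,s)‖‖G(s,t)‖` of a kernel do not see a scalar weight). -/
theorem two_cycle_invariant {E : Type*} [SeminormedAddCommGroup E] [NormedSpace ℝ E]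
    (X Y : E) {a b : ℝ} (ha : a ≠ 0) (hb : b ≠ 0) :
    ‖(a⁻¹ * b) • X‖ * ‖(b⁻¹ * a) • Y‖ = ‖X‖ * ‖Y‖ := by
  rw [norm_smul, norm_smul]
  have h : ‖a⁻¹ * b‖ * ‖b⁻¹ * a‖ = 1 := by
    rw [← norm_mul, show a⁻¹ * b * (b⁻¹ * a) = (1 : ℝ) by field_simp, norm_one]
  calc ‖a⁻¹ * b‖ * ‖X‖ * (‖b⁻¹ * a‖ * ‖Y‖)
      = (‖a⁻¹ * b‖ * ‖b⁻¹ * a‖) * (‖X‖ * ‖Y‖) := by ring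
    _ = ‖X‖ * ‖Y‖ := by rw [h, one_mul]

/-- Consequence: a lower bound on one two-cycle product is a lower bound on the sup of the
weighted kernel norms for EVERY scalar weight: if `m² ≤ ‖X‖‖Y‖` then
`m ≤ max ‖(a⁻¹ b) X‖ ‖(b⁻¹ a) Y‖`. -/
theorem two_cycle_lower_bound {E : Type*} [SeminormedAddCommGroup E] [NormedSpace ℝ E]
    (X Y : E) {a b m : ℝ} (ha : a ≠ 0) (hb : b ≠ 0)
    (hXY : m ^ 2 ≤ ‖X‖ * ‖Y‖) :
    m ≤ max ‖(a⁻¹ * b) • X‖ ‖(b⁻¹ * a) • Y‖ := by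
  set u := ‖(a⁻¹ * b) • X‖ with hu
  set v := ‖(b⁻¹ * a) • Y‖ with hv
  have huv : u * v = ‖X‖ * ‖Y‖ := two_cycle_invariant X Y ha hb
  have hu0 : 0 ≤ u := norm_nonneg _
  have hv0 : 0 ≤ v := norm_nonneg _
  by_contra hlt
  push Not at hlt
  have hu' : u < m := lt_of_le_of_lt (le_max_left u v) hlt
  have hv' : v < m := lt_of_le_of_lt (le_max_right u v) hlt
  have : u * v < m * m := mul_lt_mul'' hu' hv' hu0 hv0
  rw [huv, ← sq] at this
  exact absurd hXY (not_le.mpr this)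

end Summit.AnomalousDissipation.AnomalousDissipation.Theorems
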